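import Summits.QuantumFields.YangMills.Theorems.FixedTorusFirstTorusComparison
import Summits.QuantumFields.YangMills.Theorems.OneCertifiedCubeFiniteSizeCriterion
import Summits.QuantumFields.YangMills.Theorems.ConvexGribovBodyNonSimplyConnectedLatticeGapStubCellFiniteSizeSmallBeta
import Summits.QuantumFields.YangMills.Theorems.BalabanLadderInfVolFloorsCore
import HarnessLib

/-!
# `FixedTorusFirst` — one-point torus-size insensitivity at strong coupling

Route `route-QuantumFields-FixedTorusFirst` (sub-line under `BalabanLadder.NT`, rung R2a), crux
`Summit.QuantumFields.YangMills.Theses.FixedTorusFirst.FiniteSizeInsensitivity`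
(item `stmt-QuantumFields-27355`).  Helper file (no item is closed) for the functional
strong-coupling rung `Theorems/FixedTorusFirstStrongCouplingFunctionalRung.lean` (the crux's own
clauses (a), (b) — torus-size Cauchy property of NT's functionals `Q2`, `Q3` — on the
strong-coupling window):

* `torus_onePoint_finiteSize` — for every compact `G` and every continuous unitary matrix
  representation `ρ` there is `β₀ > 0` such that for EVERY bounded measurable cylinder
  observable `F` whose support has sup-radius `R`, all `|β| ≤ β₀` and all odd tori
  `2S+1 ≤ 2S'+1` with `R + 1 ≤ S`,
  `|E_{2S+1}[F] − E_{2S'+1}[F]| ≤ 2‖F‖ (2R+1)⁴ 2^{−⌊(S−1−R)/3⌋}`: the Dobrushin–Shlosman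
  finite-size condition at small `|β|`
  (`NonSimplyConnectedLatticeGap.stub_cellFiniteSize_smallBeta`, threshold `ε = 1/3552`, ratio
  `q = ε (7⁴ − 5⁴) = 1/2`), the influence chain rule (`FiniteSizeCriterion.box_influence_le`) on
  the box of radius `R + 3k`, and the torus DLR equation with far factor `1` on both tori
  (`abs_torusMean_sub_torusMean_le`);
* the action density `dens G r x` of the `DlrCollarTransfer` vocabulary as a bounded measurable
  cylinder observable of sup-radius `M + 1` for `x ∈ box 4 M` (the cited
  `InfiniteVolume.exists_abs_dens_le_uniform`, `continuous_dens`, `isCylinder_dens`, and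
  `radius_supp_dens`), and the resulting
  strong-coupling torus-size insensitivity of `torusE` of one, two and three densities
  (`torusE_dens_finiteSize`);
* two pieces of bookkeeping: the covariance and the third cumulant of quantities known to `C^j D`
  move by at most `3C²D`, `15C³D` (`abs_cov_sub_cov_le`, `abs_k3_sub_k3_le`).

Lattice units, `|β| ≤ β₀`; nothing about weak coupling, the continuum limit, the mass gap, `NT`
or the summit is proved here.  References: Dobrushin–Shlosman (1985) §2
[cite: DobrushinShlosman1985, §2]; Georgii (2011) §8.2 [cite: Georgii2011, §8.2].
-/

set_option autoImplicit false

noncomputable section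

open MeasureTheory Filter
open Literature.Probability.LatticeModels
open Literature.MathematicalPhysics.QuantumLattice
open Literature.MathematicalPhysics.QuantumFieldTheory (wilsonMeasure LatticeRep
  isProbabilityMeasure_wilsonMeasure measurable_torusLift)
open Summit.QuantumFields.YangMills.Theorems.FiniteSizeCriterion
open Summit.QuantumFields.YangMills.Theorems.NonSimplyConnectedLatticeGap
  (stub_cellFiniteSize_smallBeta)
open Summit.QuantumFields.YangMills.Cruxes.OSLegsFromFemtoAndGap.DlrCollarTransfer (dens torusE
  continuous_dens isCylinder_dens near_of_mem_supp_dens)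
open Summit.QuantumFields.YangMills.Theorems.InfiniteVolume (exists_abs_dens_le_uniform)

namespace Summit.QuantumFields.YangMills.Cruxes.FiniteSizeInsensitivity.Rung

/-! ## Bookkeeping: covariances and third cumulants of nearby quantities -/

/-- If `E₁₂, E₁, E₂` move by at most `C²D, CD, CD` and `|E₂| , |E₁'| ≤ C`, the covariance
`E₁₂ − E₁E₂` moves by at most `3C²D`. -/
theorem abs_cov_sub_cov_le {E₁₂ E₁ E₂ E₁₂' E₁' E₂' C D : ℝ} (hC : 0 ≤ C) (hD : 0 ≤ D)
    (h₁₂ : |E₁₂ - E₁₂'| ≤ C ^ 2 * D) (h₁ : |E₁ - E₁'| ≤ C * D) (h₂ : |E₂ - E₂'| ≤ C * D)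
    (hb₂ : |E₂| ≤ C) (hb₁ : |E₁'| ≤ C) :
    |(E₁₂ - E₁ * E₂) - (E₁₂' - E₁' * E₂')| ≤ 3 * C ^ 2 * D := by
  have e : (E₁₂ - E₁ * E₂) - (E₁₂' - E₁' * E₂') =
      (E₁₂ - E₁₂') - ((E₁ - E₁') * E₂ + E₁' * (E₂ - E₂')) := by ring
  rw [e]
  have hp1 : |(E₁ - E₁') * E₂| ≤ C * D * C := by
    rw [abs_mul]; exact mul_le_mul h₁ hb₂ (abs_nonneg _) (by positivity)
  have hp2 : |E₁' * (E₂ - E₂')| ≤ C * (C * D) := by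
    rw [abs_mul]; exact mul_le_mul hb₁ h₂ (abs_nonneg _) hC
  calc _ ≤ |E₁₂ - E₁₂'| + |(E₁ - E₁') * E₂ + E₁' * (E₂ - E₂')| := abs_sub _ _
    _ ≤ C ^ 2 * D + (C * D * C + C * (C * D)) :=
        add_le_add h₁₂ ((abs_add_le _ _).trans (add_le_add hp1 hp2))
    _ = 3 * C ^ 2 * D := by ring

/-- Products of two quantities known to `CD` resp. `C²D` and bounded by `C`, `C²`. -/
theorem abs_mul_sub_mul_le {a b a' b' C D : ℝ} {i j : ℕ} (hC : 0 ≤ C) (hD : 0 ≤ D)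
    (ha : |a - a'| ≤ C ^ i * D) (hb : |b - b'| ≤ C ^ j * D) (hbb : |b| ≤ C ^ j)
    (haa : |a'| ≤ C ^ i) : |a * b - a' * b'| ≤ 2 * C ^ (i + j) * D := by
  have e : a * b - a' * b' = (a - a') * b + a' * (b - b') := by ring
  rw [e, pow_add]
  have hp1 : |(a - a') * b| ≤ C ^ i * D * C ^ j := by
    rw [abs_mul]; exact mul_le_mul ha hbb (abs_nonneg _) (by positivity)
  have hp2 : |a' * (b - b')| ≤ C ^ i * (C ^ j * D) := by
    rw [abs_mul]; exact mul_le_mul haa hb (abs_nonneg _) (by positivity)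
  calc _ ≤ |(a - a') * b| + |a' * (b - b')| := abs_add_le _ _
    _ ≤ C ^ i * D * C ^ j + C ^ i * (C ^ j * D) := add_le_add hp1 hp2
    _ = 2 * (C ^ i * C ^ j) * D := by ring

/-- If the moments entering a third cumulant move by at most `C^j D` (`j` = number of factors) and
are bounded by `C^j`, the third cumulant
`E₁₂₃ − E₁E₂₃ − E₂E₁₃ − E₃E₁₂ + 2E₁E₂E₃` moves by at most `15C³D`. -/
theorem abs_k3_sub_k3_le {E₁₂₃ E₁₂ E₁₃ E₂₃ E₁ E₂ E₃ E₁₂₃' E₁₂' E₁₃' E₂₃' E₁' E₂' E₃' C D : ℝ}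
    (hC : 0 ≤ C) (hD : 0 ≤ D)
    (h₁₂₃ : |E₁₂₃ - E₁₂₃'| ≤ C ^ 3 * D) (h₁₂ : |E₁₂ - E₁₂'| ≤ C ^ 2 * D)
    (h₁₃ : |E₁₃ - E₁₃'| ≤ C ^ 2 * D) (h₂₃ : |E₂₃ - E₂₃'| ≤ C ^ 2 * D)
    (h₁ : |E₁ - E₁'| ≤ C ^ 1 * D) (h₂ : |E₂ - E₂'| ≤ C ^ 1 * D) (h₃ : |E₃ - E₃'| ≤ C ^ 1 * D)
    (hb₁₂ : |E₁₂| ≤ C ^ 2) (hb₁₃ : |E₁₃| ≤ C ^ 2) (hb₂₃ : |E₂₃| ≤ C ^ 2)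
    (hb₁' : |E₁'| ≤ C ^ 1) (hb₂' : |E₂'| ≤ C ^ 1) (hb₃' : |E₃'| ≤ C ^ 1)
    (hb₂ : |E₂| ≤ C ^ 1) (hb₃ : |E₃| ≤ C ^ 1) :
    |(E₁₂₃ - E₁ * E₂₃ - E₂ * E₁₃ - E₃ * E₁₂ + 2 * (E₁ * E₂ * E₃)) -
        (E₁₂₃' - E₁' * E₂₃' - E₂' * E₁₃' - E₃' * E₁₂' + 2 * (E₁' * E₂' * E₃'))| ≤
      15 * C ^ 3 * D := by
  have t1 := abs_mul_sub_mul_le (i := 1) (j := 2) hC hD h₁ h₂₃ hb₂₃ hb₁'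
  have t2 := abs_mul_sub_mul_le (i := 1) (j := 2) hC hD h₂ h₁₃ hb₁₃ hb₂'
  have t3 := abs_mul_sub_mul_le (i := 1) (j := 2) hC hD h₃ h₁₂ hb₁₂ hb₃'
  -- `E₂E₃` moves by `2C²D = C²(2D)` and is bounded by `C²`
  have hD2 : 0 ≤ 2 * D := by positivity
  have t23 := abs_mul_sub_mul_le (i := 1) (j := 1) hC hD h₂ h₃ hb₃ hb₂'
  have t23' : |E₂ * E₃ - E₂' * E₃'| ≤ C ^ 2 * (2 * D) := by
    calc _ ≤ 2 * C ^ (1 + 1) * D := t23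
      _ = C ^ 2 * (2 * D) := by ring
  have hb23 : |E₂ * E₃| ≤ C ^ 2 := by
    rw [abs_mul]
    rw [pow_one] at hb₂ hb₃
    calc |E₂| * |E₃| ≤ C * C := mul_le_mul hb₂ hb₃ (abs_nonneg _) hC
      _ = C ^ 2 := by ring
  have h₁w : |E₁ - E₁'| ≤ C ^ 1 * (2 * D) :=
    h₁.trans (mul_le_mul_of_nonneg_left (by linarith) (by positivity))
  have t123 := abs_mul_sub_mul_le (i := 1) (j := 2) hC hD2 h₁w t23' hb23 hb₁'
  have e : (E₁₂₃ - E₁ * E₂₃ - E₂ * E₁₃ - E₃ * E₁₂ + 2 * (E₁ * E₂ * E₃)) -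
      (E₁₂₃' - E₁' * E₂₃' - E₂' * E₁₃' - E₃' * E₁₂' + 2 * (E₁' * E₂' * E₃')) =
      (E₁₂₃ - E₁₂₃') - (E₁ * E₂₃ - E₁' * E₂₃') - (E₂ * E₁₃ - E₂' * E₁₃') -
        (E₃ * E₁₂ - E₃' * E₁₂') + 2 * (E₁ * (E₂ * E₃) - E₁' * (E₂' * E₃')) := by ring
  rw [e]
  have a0 := abs_le.1 h₁₂₃
  have a1 := abs_le.1 t1
  have a2 := abs_le.1 t2
  have a3 := abs_le.1 t3
  have a4 := abs_le.1 t123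
  have ep : C ^ (1 + 2) = C ^ 3 := by norm_num
  rw [ep] at a1 a2 a3 a4
  exact abs_le.2 ⟨by linarith [a0.1, a1.2, a2.2, a3.2, a4.1],
    by linarith [a0.2, a1.1, a2.1, a3.1, a4.2]⟩

/-! ## One-point torus-size insensitivity at strong coupling -/

section Torus

variable {N : ℕ} {G : Type} [Group G] [TopologicalSpace G] [IsTopologicalGroup G]
  [CompactSpace G] [T2Space G] [SecondCountableTopology G] [MeasurableSpace G] [BorelSpace G]

/-- **One-point torus-size insensitivity at strong coupling, every compact `G`.**  There is
`β₀ > 0` (depending on `G`, `ρ`) such that for every bounded measurable cylinder observable `F`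
whose support has sup-radius `R`, every `|β| ≤ β₀` and all `R + 1 ≤ S ≤ S'`, the Wilson means of
`F` on the tori `(ℤ/(2S+1))⁴`, `(ℤ/(2S'+1))⁴` differ by at most `2‖F‖(2R+1)⁴2^{−⌊(S−1−R)/3⌋}`.
Dobrushin–Shlosman finite-size condition + influence chain rule + torus DLR with far factor `1`. -/
theorem torus_onePoint_finiteSize (ρ : G →* Matrix (Fin N) (Fin N) ℂ) (hρ : Continuous ρ) :
    ∃ β₀ : ℝ, 0 < β₀ ∧ ∀ (F : LGConfig 4 G → ℝ) (CF : ℝ) (SF : Finset (ZdEdge 4)) (R : ℕ),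
      Measurable F → (∀ U, |F U| ≤ CF) → IsCylinder F SF → (∀ e ∈ SF, ∀ i, |e.1 i| ≤ R) →
      ∀ β : ℝ, |β| ≤ β₀ → ∀ S S' : ℕ, R + 1 ≤ S → S ≤ S' →
        |(∫ V, F (torusLift (2 * S + 1) V) ∂(wilsonMeasure (d := 4) (L := 2 * S + 1) ρ β)) -
          ∫ V, F (torusLift (2 * S' + 1) V) ∂(wilsonMeasure (d := 4) (L := 2 * S' + 1) ρ β)| ≤
        2 * CF * ((2 * R + 1) ^ 4 * (1 / 2 : ℝ) ^ ((S - 1 - R) / 3)) := by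
  classical
  obtain ⟨β₁, hβ₁, hFS⟩ :=
    stub_cellFiniteSize_smallBeta G N ρ hρ ((1 : ℝ) / 3552) (by norm_num)
  refine ⟨β₁ / 2, by linarith, ?_⟩
  intro F CF SF R hFm hFb hFS' hRF β hβ S S' hRS hSS'
  have hβ1 : |β| < β₁ := lt_of_le_of_lt hβ (by linarith)
  obtain ⟨k, hk⟩ : ∃ k : ℕ, k = (S - 1 - R) / 3 := ⟨_, rfl⟩
  have hk3 : k * 3 ≤ S - 1 - R := by rw [hk]; exact Nat.div_mul_le_self _ _
  obtain ⟨L, hL⟩ : ∃ L : ℕ, L = R + k * (2 * 1 + 1) := ⟨_, rfl⟩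
  have hLS : L + 1 ≤ S := by omega
  have hI1 : (L : ℤ) + 1 ≤ S := by exact_mod_cast hLS
  have hI2 : (S : ℤ) ≤ S' := by exact_mod_cast hSS'
  -- the box `Λ` of radius `L` and its geometry
  obtain ⟨Λ, hΛ⟩ : ∃ Λ : Finset (ZdEdge 4), Λ = (Fintype.piFinset fun _ : Fin 4 =>
    Finset.Ico (-(((1 : ℕ) : ℤ) * L)) (((1 : ℕ) : ℤ) * (L + 1))) ×ˢ
      (Finset.univ : Finset (Fin 4)) := ⟨_, rfl⟩
  have hmemΛ : ∀ e ∈ Λ, ∀ i, -(L : ℤ) ≤ e.1 i ∧ e.1 i ≤ L := by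
    intro e he i
    rw [hΛ, Finset.mem_product, Fintype.mem_piFinset] at he
    have h := Finset.mem_Ico.1 (he.1 i)
    simp only [Nat.cast_one, one_mul] at h
    omega
  have hRL : (R : ℤ) ≤ L := by exact_mod_cast (by omega : R ≤ L)
  have hwide : ∀ e ∈ Λ ∪ SF ∪ (plaquettesTouching Λ).biUnion plaquetteEdges, ∀ i,
      -(L : ℤ) - 1 ≤ e.1 i ∧ e.1 i ≤ L + 1 := by
    intro e he i
    simp only [Finset.mem_union] at he
    rcases he with (he | he) | he
    · have h := hmemΛ e he i
      omega
    · have h := abs_le.1 (hRF e he i)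
      omega
    · obtain ⟨e', he', hn'⟩ := exists_near_of_mem_collar he
      have h := hmemΛ e' he' i
      have h' := hn' i
      omega
  have hinj : ∀ M : ℕ, (S : ℤ) ≤ M → Set.InjOn (Torus.proj (2 * M + 1))
      ((Λ ∪ SF ∪ (plaquettesTouching Λ).biUnion plaquetteEdges).image Prod.fst :
        Set (Site 4)) := by
    intro M hM
    refine (injOn_torusProj_of_width (M := 2 * M + 1) (lo := -(L : ℤ) - 1) (hi := (L : ℤ) + 1)
      (by push_cast; linarith only [hI1, hM])).mono fun x hx => ?_
    obtain ⟨e, he, rfl⟩ := Finset.mem_image.1 (Finset.mem_coe.1 hx)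
    exact hwide e he
  -- influence bound on `ℤ⁴` and the comparison of the two tori
  have hε : (0 : ℝ) ≤ 1 / 3552 := by norm_num
  have hinfl := box_influence_le ρ hρ β (b := 1) (n := 1) le_rfl hε (hFS β hβ1) k R hFm hFb
    hFS' hRF
  rw [← hL, ← hΛ] at hinfl
  have hq :
      (1 / 3552 * ((((2 * (2 * 1 + 1) + 1) ^ 4 - (2 * (2 * 1) + 1) ^ 4 : ℕ)) : ℝ)) = 1 / 2 := by
    norm_num
  rw [hq] at hinfl
  rw [← hk]
  exact abs_torusMean_sub_torusMean_le ρ hρ β Λ hFm hFb hFS' (2 * S + 1) (2 * S' + 1)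
    (hinj S le_rfl) (hinj S' hI2) hinfl

end Torus

/-! ## The action density as a bounded cylinder observable of controlled radius -/

section Dens

variable {G : Type} [Group G] [TopologicalSpace G] [IsTopologicalGroup G] [CompactSpace G]
  [MeasurableSpace G] [BorelSpace G] (r : LatticeRep G)

/-- The support of the action density at a site of the box of radius `M` has sup-radius `M + 1`. -/
theorem radius_supp_dens {M : ℕ} {x : Site 4} (hx : x ∈ box 4 M) :
    ∀ e ∈ r.curvature.supp.image (fun e => (e.1 - -x, e.2)), ∀ i, |e.1 i| ≤ ((M + 1 : ℕ) : ℤ) := by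
  intro e he i
  have h := near_of_mem_supp_dens r he i
  have hx' := (mem_box.1 hx) i
  rw [abs_le]
  push_cast
  constructor <;> omega

end Dens

/-! ## Torus-size dependence of the moments of one, two and three densities -/

section Moments

variable {G : Type} [Group G] [TopologicalSpace G] [IsTopologicalGroup G] [CompactSpace G]
  [MeasurableSpace G] [BorelSpace G] (r : LatticeRep G)

/-- **Strong-coupling torus-size insensitivity of the density moments.**  There are `β₀ > 0` and a
bound `C ≥ 0` of the action density such that for `|β| ≤ β₀`, all sites `x, y, z` of the box of
radius `M` and all tori `M + 3 ≤ S ≤ S'`, the torus means of `dens x`, `dens x · dens y`,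
`dens x · dens y · dens z` on `(ℤ/(2S+1))⁴` and `(ℤ/(2S'+1))⁴` differ by at most `C^j D` with
`D = 2 (2(M+1)+1)⁴ 2^{−⌊(S−2−M)/3⌋}` (`j` = number of factors), and all these means are bounded by
`C^j`. -/
theorem torusE_dens_finiteSize : ∃ β₀ : ℝ, 0 < β₀ ∧ ∃ C : ℝ, 0 ≤ C ∧
    (∀ (x : Site 4) (U : LGConfig 4 G), |dens G r x U| ≤ C) ∧
    (∀ (β : ℝ) (L : ℕ) (x : Site 4), |torusE G r β L (dens G r x)| ≤ C ^ 1) ∧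
    (∀ (β : ℝ) (L : ℕ) (x y : Site 4),
      |torusE G r β L (fun U => dens G r x U * dens G r y U)| ≤ C ^ 2) ∧
    (∀ (β : ℝ) (L : ℕ) (x y z : Site 4),
      |torusE G r β L (fun U => dens G r x U * dens G r y U * dens G r z U)| ≤ C ^ 3) ∧
    ∀ β : ℝ, |β| ≤ β₀ → ∀ (M S S' : ℕ), M + 3 ≤ S → S ≤ S' → ∀ x y z : Site 4,
      x ∈ box 4 M → y ∈ box 4 M → z ∈ box 4 M →
      |torusE G r β S (dens G r x) - torusE G r β S' (dens G r x)| ≤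
          C ^ 1 * (2 * ((2 * ((M + 1 : ℕ) : ℝ) + 1) ^ 4 * (1 / 2 : ℝ) ^ ((S - 1 - (M + 1)) / 3))) ∧
      |torusE G r β S (fun U => dens G r x U * dens G r y U) -
          torusE G r β S' (fun U => dens G r x U * dens G r y U)| ≤
          C ^ 2 * (2 * ((2 * ((M + 1 : ℕ) : ℝ) + 1) ^ 4 * (1 / 2 : ℝ) ^ ((S - 1 - (M + 1)) / 3))) ∧
      |torusE G r β S (fun U => dens G r x U * dens G r y U * dens G r z U) -
          torusE G r β S' (fun U => dens G r x U * dens G r y U * dens G r z U)| ≤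
          C ^ 3 * (2 * ((2 * ((M + 1 : ℕ) : ℝ) + 1) ^ 4 *
            (1 / 2 : ℝ) ^ ((S - 1 - (M + 1)) / 3))) := by
  classical
  haveI : T2Space G := (r.continuous.isClosedEmbedding r.injective).isEmbedding.t2Space
  haveI : SecondCountableTopology G :=
    (r.continuous.isClosedEmbedding r.injective).isEmbedding.secondCountableTopology
  obtain ⟨β₀, hβ₀, h1⟩ := torus_onePoint_finiteSize r.ρ r.continuous
  obtain ⟨C, hC0, hC⟩ := exists_abs_dens_le_uniform r
  have hm : ∀ x : Site 4, Measurable (dens G r x) := fun x => (continuous_dens r x).measurable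
  -- bounds of the products
  have hb2 : ∀ (x y : Site 4) (U : LGConfig 4 G), |dens G r x U * dens G r y U| ≤ C ^ 2 :=
    fun x y U => by
      rw [abs_mul, pow_two]; exact mul_le_mul (hC x U) (hC y U) (abs_nonneg _) hC0
  have hb3 : ∀ (x y z : Site 4) (U : LGConfig 4 G),
      |dens G r x U * dens G r y U * dens G r z U| ≤ C ^ 3 := fun x y z U => by
      rw [abs_mul, pow_succ]; exact mul_le_mul (hb2 x y U) (hC z U) (abs_nonneg _) (by positivity)
  have hE : ∀ (β : ℝ) (L : ℕ) (F : LGConfig 4 G → ℝ) (B : ℝ), (∀ U, |F U| ≤ B) →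
      |torusE G r β L F| ≤ B := fun β L F B hF => by
    haveI := isProbabilityMeasure_wilsonMeasure (d := 4) (L := 2 * L + 1) r.ρ r.continuous β
    rw [torusE]
    exact abs_integral_le_of_abs_le fun U => hF _
  refine ⟨β₀, hβ₀, C, hC0, hC, fun β L x => by rw [pow_one]; exact hE β L _ _ (hC x),
    fun β L x y => hE β L _ _ (hb2 x y), fun β L x y z => hE β L _ _ (hb3 x y z), ?_⟩
  intro β hβ M S S' hMS hSS' x y z hx hy hz
  have hRS : (M + 1) + 1 ≤ S := by omega
  -- supports and radii
  have hSx := isCylinder_dens r x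
  have hSy := isCylinder_dens r y
  have hSz := isCylinder_dens r z
  have hRx := radius_supp_dens r hx
  have hRy := radius_supp_dens r hy
  have hRz := radius_supp_dens r hz
  have hSxy := Literature.MathematicalPhysics.QuantumFieldTheory.IsCylinder.mul hSx hSy
  have hSxyz := Literature.MathematicalPhysics.QuantumFieldTheory.IsCylinder.mul hSxy hSz
  have hRxy : ∀ e ∈ (r.curvature.supp.image fun e => (e.1 - -x, e.2)) ∪
      (r.curvature.supp.image fun e => (e.1 - -y, e.2)), ∀ i, |e.1 i| ≤ ((M + 1 : ℕ) : ℤ) := by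
    intro e he i
    rcases Finset.mem_union.1 he with he | he
    · exact hRx e he i
    · exact hRy e he i
  have hRxyz : ∀ e ∈ (r.curvature.supp.image fun e => (e.1 - -x, e.2)) ∪
      (r.curvature.supp.image fun e => (e.1 - -y, e.2)) ∪
      (r.curvature.supp.image fun e => (e.1 - -z, e.2)), ∀ i, |e.1 i| ≤ ((M + 1 : ℕ) : ℤ) := by
    intro e he i
    rcases Finset.mem_union.1 he with he | he
    · exact hRxy e he i
    · exact hRz e he i
  refine ⟨?_, ?_, ?_⟩
  · have h := h1 (dens G r x) C _ (M + 1) (hm x) (hC x) hSx hRx β hβ S S' hRS hSS'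
    rw [torusE, torusE, pow_one]
    push_cast at h ⊢
    exact h.trans (le_of_eq (by ring))
  · have h := h1 (fun U => dens G r x U * dens G r y U) (C ^ 2) _ (M + 1) ((hm x).mul (hm y))
      (hb2 x y) hSxy hRxy β hβ S S' hRS hSS'
    rw [torusE, torusE]
    push_cast at h ⊢
    exact h.trans (le_of_eq (by ring))
  · have h := h1 (fun U => dens G r x U * dens G r y U * dens G r z U) (C ^ 3) _ (M + 1)
      (((hm x).mul (hm y)).mul (hm z)) (hb3 x y z) hSxyz hRxyz β hβ S S' hRS hSS'
    rw [torusE, torusE]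
    push_cast at h ⊢
    exact h.trans (le_of_eq (by ring))

end Moments

end Summit.QuantumFields.YangMills.Cruxes.FiniteSizeInsensitivity.Rung

end
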